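import Summits.QuantumFields.BalabanUV.T4Continuum.Support.AveragingDeficitGradLift
import Summits.QuantumFields.BalabanUV.T4Continuum.Support.AveragingDeficitFermatAll
import HarnessLib

/-!
# AveragingDeficitDualResidualW (T⁴ programme, node NE3, row NE3-R2, gen 6) — R2ᴱ_w, THE GRADIENT-PAIRED DUAL RESIDUAL ON THE TORUS:
# `L^{d−4}·|⟨J(V̄), φ⟩| ≤ wallConst·[‖∇_V F‖_{ℓ²}·‖d_V(Sφ)‖_{ℓ²} + a²(‖Sφ‖_{ℓ¹} + ‖d_V(Sφ)‖_{ℓ¹})]` with the gradient-bounded lift `S` of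
# (γ2), hence `≤ wallConst·[‖∇_V F‖_{ℓ²}·√(cW₁·covGradSq V̄ φ + cW₂·a²·‖φ‖²_{ℓ²}) + a²·(cW₃·covGradL1 V̄ φ + cW₄·‖φ‖_{ℓ¹})]`
# (file 9 of (γ2) — record `t4/T4-EST-NE3-R2.md` v0.6 §4, last sentence)

HONEST FRAMING (cell `pub-balaban`, T4-DAG PAGE 1; unit `b2b-balaban-t4-ne3r2-p1` = owner of BINDER-OWNERS row NE3-R2, gen 6).
The cell's T4 target is the finite-torus continuum limit of the unit-scale averaged loop expectations — NOT infinite volume, NO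
mass gap, NOT Clay, NOT summit progress.  WHY.  Gen 2's `residualPairing_torus` bounds the first variation `⟨J(V̄), φ⟩` of the
`L`-lattice Wilson action at the averaged configuration along `φ` by the wall β applied to ANY periodic lift `ψ` of `φ`
(`pushDir L V ψ = φ`) along which `V` is fine-critical; gen 2–4 used the face-supported lift, whose curl is controlled only by
its VALUES — `dualResidual_torus`: `… ≤ wallConst·[‖∇_VF‖·dualC2·‖φ‖_{ℓ²} + …]`, which loses the rate in the weighted currency
(GAPS G-ne7king10-1 REPAIR, record v0.6).  THIS FILE re-assembles R2ᴱ with the GRADIENT-BOUNDED lift `S = gradLift` of (γ2)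
(`AveragingDeficitGradLift`: exact inverse, `covGradSq V (Sφ) ≤ kLift₁·covGradSq V̄ φ + kLift₂·a²·dirSq φ`) and with fine
criticality along directions of general support (`AveragingDeficitFermatAll.FineCriticalAll`, a THEOREM for Bałaban's constrained
minimisers): the flux-gradient term now pairs with the COVARIANT GRADIENT of the coarse direction.  All [folklore], 0 sorry:
§1 **`residualPairing_gradLift`**: `L^{d−4}|D_c| ≤ wallConst·[√gradFluxSq(V)·√curlSq V (Sφ) + a²(dirL1 (Sφ) + curlL1 V (Sφ))]`
on the period (`residualPairing_torus` BY NAME with `ψ = Sφ`); §2 the constants `cW₁…cW₄` and **`dualResidualW_torus`**: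
`L^{d−4}|D_c| ≤ wallConst·[√gradFluxSq(V)·√(cW₁·covGradSq (cavg L V) φ + cW₂·a²·dirSq φ) + a²·(cW₃·covGradL1 (cavg L V) φ + cW₄·dirL1 φ)]`
(`curlSq ≤ 8·covGradSq + 32da²·dirSq` of file 1, `curlL1 ≤ 2·#planes·dirL1`); §3 **`dualResidualW_avgIter`** for Bałaban's
`(j+2)`-level composite-constraint minimisers and coarse directions TANGENT to the fibre of the `(j+1)`-fold average.
WHAT IT IS NOT: the CURL-paired form of (RES♯) `NE3EnergyWeightedShapes.CurlPairedResidual` — passing from `covGradSq V̄ φ` to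
`curlSq V̄ φ` on a Landau-gauge tangent space is a covariant Gaffney∕Weitzenböck identity on the torus ((γ3), not in the tree);
not ML_w; not NE3.  Nothing of Bałaban's is asserted (context: [Balaban1985Variational] (26)–(27) p. 282, (75)–(77) p. 289,
§E (115)–(121) p. 295).  ABSOLUTE RULE kept: no printed sentence is a hypothesis.  PLACEMENT: `Summits/QuantumFields/BalabanUV/`;
imports this row's `AveragingDeficitGradLift` ∕ `AveragingDeficitFermatAll`; moves nothing.
-/

set_option autoImplicit false

open scoped BigOperators Matrix Matrix.Norms.L2Operator Topology
open NormedSpace Finset Filter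

namespace Summit.QuantumFields.BalabanUV.T4Continuum.AveragingDeficitDualResidualW

open Literature.MathematicalPhysics.QuantumFieldTheory.Balaban1983to89
open B7Prop1Explicit B7Prop2Explicit MatrixLog UnitaryModel
open T4AveragingDeficitWall hiding Site Plane Plaq Bond
open T4AveragingDeficitWallBoundary (IsPeriodicCfg periodBox blockSites_periodBox)
open AveragingDeficitPeriodicCounting (IsPeriodicDir natCast_mul_period)
open AveragingDeficitDerivWallProof (wallConst wallConst_nonneg)
open AveragingDeficitResidualPairing (pushDir coarseActionOf residualPairing_torus)
open AveragingDeficitChartCalculus (cavg)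
open AveragingDeficitCovGrad (covFd covGradSq covGradSq_nonneg curlSq_le_covGradSq)
open AveragingDeficitDualResidual (coarseActionOf_vary_congr curlL1_le_periodic)
open AveragingDeficitTwoLevelPrep (smallness_of_twoLevelSmall cavg_isUnitaryCfg smallField_cavg)
open AveragingDeficitMultiLevelPrep (tower levelQ' TangentIter levelQ'_resDir_eq_zero tower_ne_zero LevelSmall prop1Radius_nonneg)
open AveragingDeficitTorusChart (resDir)
open AveragingDeficitFermat (isPeriodicCfg_cavg small512_of_liftSmall)
open AveragingDeficitMultiLevelBridge (cavgIter_eq_avgIter)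
open BlockAverageVaryHolo (nbRad)
open AveragingDeficitBlockDensity AveragingDeficitBlockDensityGradSum AveragingDeficitBlockDensityPush AveragingDeficitLiftDefectSum
open AveragingDeficitGradLift AveragingDeficitFermatAll

noncomputable section

variable {d : ℕ} {n : Type*} [Fintype n] [DecidableEq n]

section Torus

variable [Nonempty n] {L : ℕ} (hL : 1 ≤ L) {U : Site d → Fin d → (Matrix n n ℂ)ˣ} (hU : IsUnitaryCfg U) {a : ℝ} (ha : 0 ≤ a)
  (h512 : 512 * (d + 1) * (d + 4) * (L : ℝ) ^ 2 * a ≤ 1) (hUa : SmallField U a)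

/-! ## §1 The residual pairing with the gradient-bounded lift -/

include hL h512 in
omit [Fintype n] [DecidableEq n] [Nonempty n] in
/-- The standard smallness in the form `a ≤ 1/(512(d+1)(d+4)L²)`. [folklore] -/
theorem le_one_div_of_small512 : a ≤ 1 / (512 * (d + 1) * (d + 4) * (L : ℝ) ^ 2) := by
  have hK : (0 : ℝ) < 512 * (d + 1) * (d + 4) * (L : ℝ) ^ 2 := by
    have : (0 : ℝ) < L := by exact_mod_cast (by omega : 0 < L)
    positivity
  rw [le_div_iff₀ hK]; linarith

include hL ha h512 in
omit [Fintype n] [DecidableEq n] [Nonempty n] in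
/-- The standard smallness gives `a ≤ 1`. [folklore] -/
theorem le_one_of_small512 : a ≤ 1 := by
  have hL1 : (1 : ℝ) ≤ L := by exact_mod_cast hL
  have hd : (0 : ℝ) ≤ d := Nat.cast_nonneg d
  have hL2 : (1 : ℝ) ≤ (L : ℝ) ^ 2 := by nlinarith
  have hK : (1 : ℝ) ≤ 512 * (d + 1) * (d + 4) * (L : ℝ) ^ 2 := by
    nlinarith [mul_nonneg (mul_nonneg hd hd) (sq_nonneg (L : ℝ)), mul_nonneg hd (sq_nonneg (L : ℝ))]
  calc a = 1 * a := by ring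
    _ ≤ 512 * (d + 1) * (d + 4) * (L : ℝ) ^ 2 * a := mul_le_mul_of_nonneg_right hK ha
    _ ≤ 1 := h512

/-- **R2ᴱ WITH THE GRADIENT-BOUNDED LIFT**: for `U` unitary of period `L·M` in `SmallField U a` (`512(d+1)(d+4)L²a ≤ 1`) that is
fine-critical along periodic `𝔲(N)` directions of general support with admissible push-forward (`FineCriticalAll L M U Tc`), every
`M`-periodic coarse `𝔲(N)` direction `φ` with `Tc φ`, every fine-lattice field `Φ` agreeing with `φ` at the block corners and every
derivative `D_c` at `0` of `s ↦ A^L_{[0,M)^d}(V̄ e^{sΦ})`: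
`L^{d−4}|D_c| ≤ wallConst·[√gradFluxSq(U)·√curlSq U (Sφ) + a²(dirL1 (Sφ) + curlL1 U (Sφ))]` over the period, `S = gradLift`. [folklore] -/
theorem residualPairing_gradLift {M : ℕ} (hM : 1 ≤ M) (hUP : IsPeriodicCfg U ((L : ℤ) * M))
    {Tc : (Site d → Fin d → Matrix n n ℂ) → Prop} (hcrit : FineCriticalAll L M U Tc)
    (φ : Site d → Fin d → Matrix n n ℂ) (hφs : ∀ (y : Site d) (κ : Fin d), φ y κ ∈ skewAdjoint (Matrix n n ℂ))
    (hφP : IsPeriodicDir φ (M : ℤ)) (hφT : Tc φ)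
    (Φ : Site d → Fin d → Matrix n n ℂ) (hΦ : ∀ (y : Site d) (κ : Fin d), Φ ((L : ℤ) • y) κ = φ y κ) {Dc : ℝ}
    (hDc : HasDerivAt (fun s : ℝ => coarseActionOf L (vary (bavg L U) Φ s) (blockWindow L (periodBox M)).1) Dc 0) :
    (L : ℝ) ^ ((d : ℤ) - 4) * |Dc|
      ≤ wallConst d L * (Real.sqrt (gradFluxSq U (periodBox (L * M)))
          * Real.sqrt (curlSq U (gradLift hL hU ha h512 hUa φ) (periodBox (L * M)))
        + a ^ 2 * (dirL1 (gradLift hL hU ha h512 hUa φ) (periodBox (L * M))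
            + curlL1 U (gradLift hL hU ha h512 hUa φ) (periodBox (L * M)))) := by
  set Ψ := gradLift hL hU ha h512 hUa φ with hΨ
  have hΨs : IsSkewDir Ψ := isSkewDir_gradLift hL hU ha h512 hUa hφs
  have hΨP : IsPeriodicDir Ψ ((L : ℤ) * M) := isPeriodicDir_gradLift hL hU ha h512 hUa hUP hφP
  have hpush : (fun y κ => pushDir L U Ψ ((L : ℤ) • y) κ) = φ := by
    funext y κ; exact pushDir_gradLift hL hU ha h512 hUa φ y κ
  have hcritΨ := hcrit Ψ hΨs hΨP (by rw [hpush]; exact hφT)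
  have hDc' : HasDerivAt
      (fun s : ℝ => coarseActionOf L (vary (bavg L U) (pushDir L U Ψ) s) (blockWindow L (periodBox M)).1) Dc 0 := by
    refine hDc.congr_of_eventuallyEq (Filter.Eventually.of_forall fun s => ?_)
    exact coarseActionOf_vary_congr L (bavg L U) (fun y κ => by rw [pushDir_gradLift, hΦ]) s _
  have key := residualPairing_torus L hL hM hU hUP ha (le_one_div_of_small512 hL h512) hUa hΨs hΨP hcritΨ hDc'
  rwa [blockSites_periodBox L M hL] at key

/-! ## §2 The gradient-paired form -/

/-- `cW₁ = 8·kLift₁ + 512·d²·L^{d−1}`. [folklore] -/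
def cW₁ (d L : ℕ) : ℝ := 8 * kLift₁ d L + 512 * (d : ℝ) ^ 2 * (L : ℝ) ^ (d - 1)

/-- `cW₂ = 8·kLift₂ + 32d·(2L^d/L² + 16dL^{d−1}(2nbRad+1)^d·kPush²)`. [folklore] -/
def cW₂ (d L : ℕ) : ℝ :=
  8 * kLift₂ d L + 32 * d * (2 * ((L : ℝ) ^ d / (L : ℝ) ^ 2) + 16 * d * (L : ℝ) ^ (d - 1) * (2 * nbRad d L + 1) ^ d * kPush d L ^ 2)

/-- `cW₃ = (1 + 2·#planes)·2L^{d−1}`. [folklore] -/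
def cW₃ (d L : ℕ) : ℝ := (1 + 2 * Fintype.card (T4AveragingDeficitWall.Plane d)) * (2 * (L : ℝ) ^ (d - 1))

/-- `cW₄ = (1 + 2·#planes)·(L^d/L + 2dL^{d−1}(2nbRad+1)^d·kPush)`. [folklore] -/
def cW₄ (d L : ℕ) : ℝ :=
  (1 + 2 * Fintype.card (T4AveragingDeficitWall.Plane d))
    * ((L : ℝ) ^ d / L + 2 * (L : ℝ) ^ (d - 1) * (d * (2 * nbRad d L + 1) ^ d * kPush d L))

include hL hU ha h512 hUa in
/-- The dressed curl of the lift against the coarse covariant gradient: `curlSq U (Sφ) ≤ cW₁·covGradSq (cavg L U) φ + cW₂·a²·dirSq φ`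
over one period. [folklore] -/
theorem curlSq_gradLift_le {M : ℕ} (hM : 1 ≤ M) (hUP : IsPeriodicCfg U ((L : ℤ) * M)) {φ : Site d → Fin d → Matrix n n ℂ}
    (hφ : IsPeriodicDir φ (M : ℤ)) :
    curlSq U (gradLift hL hU ha h512 hUa φ) (periodBox (L * M))
      ≤ cW₁ d L * covGradSq (cavg L U) φ (periodBox M) + cW₂ d L * a ^ 2 * dirSq φ (periodBox M) := by
  have hLM : 1 ≤ L * M := Nat.one_le_iff_ne_zero.mpr (Nat.mul_ne_zero (by omega) (by omega))
  have hΨP : IsPeriodicDir (gradLift hL hU ha h512 hUa φ) ((L * M : ℕ) : ℤ) := by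
    rw [natCast_mul_period]; exact isPeriodicDir_gradLift hL hU ha h512 hUa hUP hφ
  have h1 := curlSq_le_covGradSq hLM hU hUa hΨP
  have h2 := covGradSq_gradLift_le hL hU ha h512 hUa hM hUP hφ
  have h3 := dirSq_gradLift_le hL hU ha h512 hUa hM hUP hφ
  have ha1 : a ≤ 1 := le_one_of_small512 hL ha h512
  have ha2 : a ^ 2 ≤ 1 := by nlinarith
  have hcg0 : 0 ≤ covGradSq (cavg L U) φ (periodBox M) := covGradSq_nonneg _ _ _
  have hds0 : 0 ≤ dirSq φ (periodBox M) := Finset.sum_nonneg fun _ _ => Finset.sum_nonneg fun _ _ => sq_nonneg _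
  have hLd0 : 0 ≤ (L : ℝ) ^ (d - 1) := by positivity
  have hR0 : (0 : ℝ) ≤ (2 * nbRad d L + 1) ^ d := by positivity
  have hk0 : 0 ≤ kPush d L ^ 2 := sq_nonneg _
  have hd0 : (0 : ℝ) ≤ d := Nat.cast_nonneg d
  -- `32 d a² · dirSq(Sφ)` with `a² ≤ 1` on the gradient part
  have hA : 32 * d * a ^ 2 * (16 * d * (L : ℝ) ^ (d - 1) * covGradSq (cavg L U) φ (periodBox M))
      ≤ 512 * (d : ℝ) ^ 2 * (L : ℝ) ^ (d - 1) * covGradSq (cavg L U) φ (periodBox M) := by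
    have : 0 ≤ (d : ℝ) ^ 2 * (L : ℝ) ^ (d - 1) * covGradSq (cavg L U) φ (periodBox M) := by positivity
    nlinarith
  have hB : 32 * d * a ^ 2 * ((2 * ((L : ℝ) ^ d / (L : ℝ) ^ 2)
        + 16 * d * (L : ℝ) ^ (d - 1) * (2 * nbRad d L + 1) ^ d * (kPush d L * a) ^ 2) * dirSq φ (periodBox M))
      ≤ 32 * d * (2 * ((L : ℝ) ^ d / (L : ℝ) ^ 2) + 16 * d * (L : ℝ) ^ (d - 1) * (2 * nbRad d L + 1) ^ d * kPush d L ^ 2)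
        * a ^ 2 * dirSq φ (periodBox M) := by
    have ha4 : a ^ 2 * a ^ 2 ≤ a ^ 2 := mul_le_of_le_one_right (sq_nonneg a) ha2
    have e1 : 32 * d * a ^ 2 * ((2 * ((L : ℝ) ^ d / (L : ℝ) ^ 2)
          + 16 * d * (L : ℝ) ^ (d - 1) * (2 * nbRad d L + 1) ^ d * (kPush d L * a) ^ 2) * dirSq φ (periodBox M))
        = 32 * d * (2 * ((L : ℝ) ^ d / (L : ℝ) ^ 2)) * dirSq φ (periodBox M) * a ^ 2
          + 32 * d * (16 * d * (L : ℝ) ^ (d - 1) * (2 * nbRad d L + 1) ^ d * kPush d L ^ 2) * dirSq φ (periodBox M)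
            * (a ^ 2 * a ^ 2) := by ring
    have e2 : 32 * d * (2 * ((L : ℝ) ^ d / (L : ℝ) ^ 2) + 16 * d * (L : ℝ) ^ (d - 1) * (2 * nbRad d L + 1) ^ d * kPush d L ^ 2)
          * a ^ 2 * dirSq φ (periodBox M)
        = 32 * d * (2 * ((L : ℝ) ^ d / (L : ℝ) ^ 2)) * dirSq φ (periodBox M) * a ^ 2
          + 32 * d * (16 * d * (L : ℝ) ^ (d - 1) * (2 * nbRad d L + 1) ^ d * kPush d L ^ 2) * dirSq φ (periodBox M)
            * a ^ 2 := by ring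
    rw [e1, e2]
    have hcoef : 0 ≤ 32 * d * (16 * d * (L : ℝ) ^ (d - 1) * (2 * nbRad d L + 1) ^ d * kPush d L ^ 2) * dirSq φ (periodBox M) := by
      positivity
    exact add_le_add le_rfl (mul_le_mul_of_nonneg_left ha4 hcoef)
  calc curlSq U (gradLift hL hU ha h512 hUa φ) (periodBox (L * M))
      ≤ 8 * covGradSq U (gradLift hL hU ha h512 hUa φ) (periodBox (L * M))
        + 32 * d * a ^ 2 * dirSq (gradLift hL hU ha h512 hUa φ) (periodBox (L * M)) := h1
    _ ≤ 8 * (kLift₁ d L * covGradSq (cavg L U) φ (periodBox M) + kLift₂ d L * a ^ 2 * dirSq φ (periodBox M))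
        + 32 * d * a ^ 2 * (16 * d * (L : ℝ) ^ (d - 1) * covGradSq (cavg L U) φ (periodBox M)
          + (2 * ((L : ℝ) ^ d / (L : ℝ) ^ 2) + 16 * d * (L : ℝ) ^ (d - 1) * (2 * nbRad d L + 1) ^ d * (kPush d L * a) ^ 2)
            * dirSq φ (periodBox M)) := by gcongr
    _ ≤ 8 * (kLift₁ d L * covGradSq (cavg L U) φ (periodBox M) + kLift₂ d L * a ^ 2 * dirSq φ (periodBox M))
        + (512 * (d : ℝ) ^ 2 * (L : ℝ) ^ (d - 1) * covGradSq (cavg L U) φ (periodBox M)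
          + 32 * d * (2 * ((L : ℝ) ^ d / (L : ℝ) ^ 2) + 16 * d * (L : ℝ) ^ (d - 1) * (2 * nbRad d L + 1) ^ d * kPush d L ^ 2)
            * a ^ 2 * dirSq φ (periodBox M)) := by
        refine add_le_add le_rfl ?_
        have e : 32 * d * a ^ 2 * (16 * d * (L : ℝ) ^ (d - 1) * covGradSq (cavg L U) φ (periodBox M)
            + (2 * ((L : ℝ) ^ d / (L : ℝ) ^ 2) + 16 * d * (L : ℝ) ^ (d - 1) * (2 * nbRad d L + 1) ^ d * (kPush d L * a) ^ 2)
              * dirSq φ (periodBox M))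
            = 32 * d * a ^ 2 * (16 * d * (L : ℝ) ^ (d - 1) * covGradSq (cavg L U) φ (periodBox M))
              + 32 * d * a ^ 2 * ((2 * ((L : ℝ) ^ d / (L : ℝ) ^ 2)
                + 16 * d * (L : ℝ) ^ (d - 1) * (2 * nbRad d L + 1) ^ d * (kPush d L * a) ^ 2) * dirSq φ (periodBox M)) := by ring
        rw [e]
        exact add_le_add hA hB
    _ = cW₁ d L * covGradSq (cavg L U) φ (periodBox M) + cW₂ d L * a ^ 2 * dirSq φ (periodBox M) := by
        rw [cW₁, cW₂]; ring

include hL hU ha h512 hUa in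
/-- The `ℓ¹` slots of the lift: `dirL1 (Sφ) + curlL1 U (Sφ) ≤ cW₃·covGradL1 (cavg L U) φ + cW₄·dirL1 φ` over one period. [folklore] -/
theorem l1_gradLift_le {M : ℕ} (hM : 1 ≤ M) (hUP : IsPeriodicCfg U ((L : ℤ) * M)) {φ : Site d → Fin d → Matrix n n ℂ}
    (hφ : IsPeriodicDir φ (M : ℤ)) :
    dirL1 (gradLift hL hU ha h512 hUa φ) (periodBox (L * M)) + curlL1 U (gradLift hL hU ha h512 hUa φ) (periodBox (L * M))
      ≤ cW₃ d L * covGradL1 (cavg L U) φ (periodBox M) + cW₄ d L * dirL1 φ (periodBox M) := by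
  have hLM : 1 ≤ L * M := Nat.one_le_iff_ne_zero.mpr (Nat.mul_ne_zero (by omega) (by omega))
  have hΨP : IsPeriodicDir (gradLift hL hU ha h512 hUa φ) ((L * M : ℕ) : ℤ) := by
    rw [natCast_mul_period]; exact isPeriodicDir_gradLift hL hU ha h512 hUa hUP hφ
  have h1 := curlL1_le_periodic hU hLM hΨP
  have h2 := dirL1_gradLift_le hL hU ha h512 hUa hM hUP hφ
  have ha1 : a ≤ 1 := le_one_of_small512 hL ha h512
  have hP0 : (0 : ℝ) ≤ Fintype.card (T4AveragingDeficitWall.Plane d) := Nat.cast_nonneg _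
  have hdl0 : 0 ≤ dirL1 (gradLift hL hU ha h512 hUa φ) (periodBox (L * M)) :=
    Finset.sum_nonneg fun _ _ => Finset.sum_nonneg fun _ _ => norm_nonneg _
  have hdφ0 : 0 ≤ dirL1 φ (periodBox M) := Finset.sum_nonneg fun _ _ => Finset.sum_nonneg fun _ _ => norm_nonneg _
  have hcg0 : 0 ≤ covGradL1 (cavg L U) φ (periodBox M) :=
    Finset.sum_nonneg fun _ _ => Finset.sum_nonneg fun _ _ => Finset.sum_nonneg fun _ _ => norm_nonneg _
  have hk0 : 0 ≤ kPush d L := by unfold kPush cDb; positivity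
  have hLd0 : 0 ≤ (L : ℝ) ^ (d - 1) := by positivity
  -- `kPush·a ≤ kPush`
  have h2' : dirL1 (gradLift hL hU ha h512 hUa φ) (periodBox (L * M))
      ≤ 2 * (L : ℝ) ^ (d - 1) * covGradL1 (cavg L U) φ (periodBox M)
        + ((L : ℝ) ^ d / L + 2 * (L : ℝ) ^ (d - 1) * (d * (2 * nbRad d L + 1) ^ d * kPush d L)) * dirL1 φ (periodBox M) := by
    refine h2.trans (add_le_add le_rfl (mul_le_mul_of_nonneg_right ?_ hdφ0))
    have h0 : 0 ≤ 2 * (L : ℝ) ^ (d - 1) * (d * (2 * nbRad d L + 1) ^ d) := by positivity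
    nlinarith [mul_nonneg h0 hk0]
  calc dirL1 (gradLift hL hU ha h512 hUa φ) (periodBox (L * M)) + curlL1 U (gradLift hL hU ha h512 hUa φ) (periodBox (L * M))
      ≤ (1 + 2 * Fintype.card (T4AveragingDeficitWall.Plane d)) * dirL1 (gradLift hL hU ha h512 hUa φ) (periodBox (L * M)) := by
        nlinarith
    _ ≤ (1 + 2 * Fintype.card (T4AveragingDeficitWall.Plane d))
        * (2 * (L : ℝ) ^ (d - 1) * covGradL1 (cavg L U) φ (periodBox M)
          + ((L : ℝ) ^ d / L + 2 * (L : ℝ) ^ (d - 1) * (d * (2 * nbRad d L + 1) ^ d * kPush d L)) * dirL1 φ (periodBox M)) :=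
        mul_le_mul_of_nonneg_left h2' (by positivity)
    _ = cW₃ d L * covGradL1 (cavg L U) φ (periodBox M) + cW₄ d L * dirL1 φ (periodBox M) := by rw [cW₃, cW₄]; ring

include hL hU ha h512 hUa in
/-- **R2ᴱ_w, THE GRADIENT-PAIRED DUAL RESIDUAL ON THE TORUS**: under the hypotheses of `residualPairing_gradLift`,
`L^{d−4}|D_c| ≤ wallConst·[√gradFluxSq(U)·√(cW₁·covGradSq (cavg L U) φ + cW₂·a²·dirSq φ) + a²·(cW₃·covGradL1 (cavg L U) φ + cW₄·dirL1 φ)]`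
over one coarse period — the flux-gradient term pairs with the COVARIANT GRADIENT of `φ`. Dictionary: `U = U_{k+1}(V′)`,
`cavg L U = W_k(V′)`, `D_c = ⟨J(W_k(V′)), φ⟩`. [cite: Balaban1985Variational, (26)–(27) p.282] -/
theorem dualResidualW_torus {M : ℕ} (hM : 1 ≤ M) (hUP : IsPeriodicCfg U ((L : ℤ) * M))
    {Tc : (Site d → Fin d → Matrix n n ℂ) → Prop} (hcrit : FineCriticalAll L M U Tc)
    (φ : Site d → Fin d → Matrix n n ℂ) (hφs : ∀ (y : Site d) (κ : Fin d), φ y κ ∈ skewAdjoint (Matrix n n ℂ))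
    (hφP : IsPeriodicDir φ (M : ℤ)) (hφT : Tc φ)
    (Φ : Site d → Fin d → Matrix n n ℂ) (hΦ : ∀ (y : Site d) (κ : Fin d), Φ ((L : ℤ) • y) κ = φ y κ) {Dc : ℝ}
    (hDc : HasDerivAt (fun s : ℝ => coarseActionOf L (vary (bavg L U) Φ s) (blockWindow L (periodBox M)).1) Dc 0) :
    (L : ℝ) ^ ((d : ℤ) - 4) * |Dc|
      ≤ wallConst d L * (Real.sqrt (gradFluxSq U (periodBox (L * M)))
          * Real.sqrt (cW₁ d L * covGradSq (cavg L U) φ (periodBox M) + cW₂ d L * a ^ 2 * dirSq φ (periodBox M))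
        + a ^ 2 * (cW₃ d L * covGradL1 (cavg L U) φ (periodBox M) + cW₄ d L * dirL1 φ (periodBox M))) := by
  have key := residualPairing_gradLift hL hU ha h512 hUa hM hUP hcrit φ hφs hφP hφT Φ hΦ hDc
  refine key.trans (mul_le_mul_of_nonneg_left ?_ (wallConst_nonneg d L))
  have hg : 0 ≤ Real.sqrt (gradFluxSq U (periodBox (L * M))) := Real.sqrt_nonneg _
  refine add_le_add (mul_le_mul_of_nonneg_left (Real.sqrt_le_sqrt (curlSq_gradLift_le hL hU ha h512 hUa hM hUP hφP)) hg) ?_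
  exact mul_le_mul_of_nonneg_left (l1_gradLift_le hL hU ha h512 hUa hM hUP hφP) (sq_nonneg a)

end Torus

/-! ## §3 Bałaban's multi-level constrained minimisers -/

/-- **R2ᴱ_w FOR HONEST `(j+2)`-LEVEL CONSTRAINED MINIMISERS** (the `U_{k+1}` vs `U_k` setting of B11 §E, every number of levels;
the tree's `k`-fold average (43)): if `V` (unitary, period `L·(L·tower j)`, `|V(∂p) − 1| ≤ a < b`, `LevelSmall (j+1) b`) minimises the
fine Wilson action of the period among the unitary `U` of the same period with `|U(∂p) − 1| ≤ b` and the same `(j+2)`-fold average,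
then for EVERY periodic coarse `𝔲(N)` direction `φ` TANGENT TO THE FIBRE OF THE `(j+1)`-FOLD AVERAGE at `cavg L V` and every
derivative `D_c` at `0` of `s ↦ A^L(V̄ e^{sΦ})` (`Φ = φ` at the block corners):
`L^{d−4}|D_c| ≤ wallConst·[√gradFluxSq(V)·√(cW₁·covGradSq V̄ φ + cW₂·a²·‖φ‖²) + a²(cW₃·covGradL1 V̄ φ + cW₄·‖φ‖₁)]`.
[cite: Balaban1985Variational, (26)–(27) p.282, §E (115)–(121) p.295] -/
theorem dualResidualW_avgIter [Nonempty n] {L M' : ℕ} [NeZero L] [NeZero M'] (j : ℕ) {V : Site d → Fin d → (Matrix n n ℂ)ˣ}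
    (hV : IsUnitaryCfg V) (hVP : IsPeriodicCfg V ((L : ℤ) * (L * tower L M' j : ℕ))) {a b : ℝ} (ha : 0 ≤ a)
    (hab : a < b) (hb : LevelSmall d L (j + 1) b) (hVa : SmallField V a)
    (hmin : ∀ U : Site d → Fin d → (Matrix n n ℂ)ˣ, IsUnitaryCfg U → IsPeriodicCfg U ((L : ℤ) * (L * tower L M' j : ℕ)) →
      SmallField U b → avgIter L U (j + 2) = avgIter L V (j + 2) →
        fineAction V (blockWindow L (periodBox (L * tower L M' j))).2
          ≤ fineAction U (blockWindow L (periodBox (L * tower L M' j))).2)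
    (φ : Site d → Fin d → Matrix n n ℂ) (hφs : ∀ (y : Site d) (κ : Fin d), φ y κ ∈ skewAdjoint (Matrix n n ℂ))
    (hφP : IsPeriodicDir φ ((L * tower L M' j : ℕ) : ℤ)) (hφT : TangentIter L j (cavg L V) φ)
    (Φ : Site d → Fin d → Matrix n n ℂ) (hΦ : ∀ (y : Site d) (κ : Fin d), Φ ((L : ℤ) • y) κ = φ y κ) {Dc : ℝ}
    (hDc : HasDerivAt
      (fun s : ℝ => coarseActionOf L (vary (bavg L V) Φ s) (blockWindow L (periodBox (L * tower L M' j))).1) Dc 0) :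
    ∃ _ : 512 * (d + 1) * (d + 4) * (L : ℝ) ^ 2 * a ≤ 1,
      (L : ℝ) ^ ((d : ℤ) - 4) * |Dc|
        ≤ wallConst d L * (Real.sqrt (gradFluxSq V (periodBox (L * (L * tower L M' j))))
            * Real.sqrt (cW₁ d L * covGradSq (cavg L V) φ (periodBox (L * tower L M' j))
                + cW₂ d L * a ^ 2 * dirSq φ (periodBox (L * tower L M' j)))
          + a ^ 2 * (cW₃ d L * covGradL1 (cavg L V) φ (periodBox (L * tower L M' j))
              + cW₄ d L * dirL1 φ (periodBox (L * tower L M' j)))) := by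
  have hL : 1 ≤ L := Nat.one_le_iff_ne_zero.mpr (NeZero.ne L)
  have hLN : 1 ≤ L * tower L M' j := Nat.one_le_iff_ne_zero.mpr (Nat.mul_ne_zero (NeZero.ne L) (tower_ne_zero L M' j))
  have haS : LevelSmall d L (j + 1) a := LevelSmall.mono ha hab.le hb
  obtain ⟨hliftA, -, -, -⟩ := smallness_of_twoLevelSmall (d := d) hL ha haS.1
  have h512a := small512_of_liftSmall hL ha hliftA
  have hcrit := fineCriticalAll_avgIter j hV hVP ha hab hb hVa hmin
  have hV₁P : IsPeriodicCfg (cavg L V) ((L : ℤ) * (tower L M' j : ℕ)) := by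
    have h := isPeriodicCfg_cavg L (L * tower L M' j) hVP
    have e : (((L * tower L M' j : ℕ)) : ℤ) = (L : ℤ) * (tower L M' j : ℕ) := by push_cast; ring
    rw [e] at h
    exact h
  have hφT' : levelQ' L M' j (cavg L V) (resDir (L * tower L M' j) fun y κ => φ y κ) = 0 :=
    levelQ'_resDir_eq_zero hL j (cavg_isUnitaryCfg hL hV ha h512a hVa) hV₁P (prop1Radius_nonneg ha) haS.2
      (smallField_cavg hL hV ha h512a hVa) hφP hφT
  have hφP' : IsPeriodicDir φ ((L * tower L M' j : ℕ) : ℤ) := hφP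
  refine ⟨h512a, ?_⟩
  exact dualResidualW_torus hL hV ha h512a hVa hLN hVP hcrit φ hφs (by exact_mod_cast hφP') hφT' Φ hΦ hDc

end

end Summit.QuantumFields.BalabanUV.T4Continuum.AveragingDeficitDualResidualW
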